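import Mathlib.LinearAlgebra.Matrix.Trace
import Mathlib.Data.Matrix.Basis
import Mathlib.Data.Matrix.Mul
import Literature.Barriers.ValiantsHypothesis.ShiftedPartialsDegenerations
import Literature.Computability.AlgebraicComplexity.StandardFamilies
import HarnessLib

/-!
# Degenerations of the iterated matrix multiplication polynomial `IMM^m_n`
(Gesmundo–Landsberg 2019, §3 Prop. 9 and §4 — a coordinate version)

Support file for the barrier entry `UnpaddedShiftedPartials.lean` (Gesmundo–Landsberg, *Explicit
polynomial sequences with maximal spaces of partial derivatives and a question of K. Mulmuley*,
Theory of Computing 15 (2019), Thm. 2). The printed proof of Thm. 2 (§4) compares the permanent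
with DEGENERATIONS of `IMM^m_n = trace(X_1 ⋯ X_m)`: "we degenerate `IMM^m_n` to `f_{n,k}` if
`m = 2k` is even and to `f̃_{n,k}` if `m = 2k+1` is odd. This is possible by Proposition 9"
(`f_{n,k} = q_nᵏ`, `q_n = x_1² + ⋯ + x_n²`; Prop. 9 realises `f_{n,k}` as a specialisation of the
matrix powering polynomial via the eigenvalues of a bordered matrix).

This file gives a direct COORDINATE realisation of such degenerations as substitutions of the
variables of `IMM^m_n` by variables-or-zero (hence elements of the `End`-orbit, by the tree's
`aeval_option_mem_endOrbit`), avoiding eigenvalues: with `A = e₀ xᵀ` (first row `x`) and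
`B = x e₀ᵀ` (first column `x`) one has `A B = q · E₀₀`, so

* `trace((AB)ᵏ) = qᵏ` (`exists_endOrbit_immPoly_eq_sumSq_pow`, `m = 2k ≥ 2`), and
* `trace(Y (AB)ᵏ) = y · qᵏ` with `Y = y E₀₀`, `y` a variable NOT among the `x`
  (`exists_endOrbit_immPoly_eq_X_mul_sumSq_pow`, `m = 2k+1`; this replaces the printed
  `f̃ = ℓ q^k`, `ℓ = Σ xᵢ`, whose flattenings need GL's Thm. 7 — with a fresh variable `y` the
  derivatives of `y qᵏ` are read off those of `qᵏ`),
* and the closed walk at the vertex `0`: `trace(∏ₜ x⁽ᵗ⁾₀₀ E₀₀) = ∏ₜ x⁽ᵗ⁾₀₀`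
  (`exists_endOrbit_immPoly_eq_prod_X`).

Here `q = Σ_{i < z} X_{v i}²` for any injection `v : Fin z → σ` with `z ≤ n` (the `x`-entries beyond
`z` are set to `0`), `σ = Fin m × Fin n × Fin n` the variables of the tree's `immPoly n m K`.
The general evaluation formula is `aeval_immPoly`.

## References

* [GesmundoLandsberg2017] F. Gesmundo, J. M. Landsberg, Theory Comput. 15 (2019), art. 3
  (arXiv:1705.03866), Def. 1, Prop. 9, §4.
-/

noncomputable section

namespace Literature.Barriers.ValiantsHypothesis

open MvPolynomial Literature.Computability.AlgebraicComplexity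

section Eval

variable {K : Type*} [CommRing K]

/-- Evaluating `IMM^m_n = trace(X_1 ⋯ X_m)` under an algebra map: substitute the entries.
[cite: GesmundoLandsberg2017, Def. 1] -/
theorem aeval_immPoly {A : Type*} [CommRing A] [Algebra K A] (n m : ℕ)
    (g : Fin m × Fin n × Fin n → A) :
    aeval g (immPoly n m K) =
      ((List.finRange m).map fun t => Matrix.of fun i j => g (t, i, j)).prod.trace := by
  set F : MvPolynomial (Fin m × Fin n × Fin n) K →+* A := (aeval g).toRingHom with hFdef
  have hF : ∀ p, F p = aeval g p := fun p => rfl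
  have hG : ∀ t : Fin m, F.mapMatrix ((Matrix.mvPolynomialX (Fin n) (Fin n) K).map
      (rename fun ij : Fin n × Fin n => (t, ij))) = Matrix.of fun i j => g (t, i, j) := by
    intro t
    ext i j
    simp [RingHom.mapMatrix_apply, Matrix.mvPolynomialX, hF]
  have hM : F.mapMatrix (immMatrix (Fin n) m K) =
      ((List.finRange m).map fun t => Matrix.of fun i j => g (t, i, j)).prod := by
    unfold immMatrix
    rw [map_list_prod, List.map_map]
    congr 1
    exact List.map_congr_left fun t _ => hG t
  unfold immPoly
  rw [← hF, show F (immMatrix (Fin n) m K).trace = (F.mapMatrix (immMatrix (Fin n) m K)).trace from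
    AddMonoidHom.map_trace F.toAddMonoidHom _, hM]

end Eval

/-! ### Matrix bookkeeping: products of `E₀₀`-type matrices -/

section MatrixLemmas

variable {R : Type*} [CommRing R] {n : ℕ} [NeZero n]

/-- `E₀₀(a) · (q • E₀₀(1))ᵏ = E₀₀(a qᵏ)`. [folklore] -/
theorem single_mul_smul_single_pow (a q : R) (k : ℕ) :
    Matrix.single (0 : Fin n) (0 : Fin n) a * (q • Matrix.single (0 : Fin n) (0 : Fin n) (1 : R)) ^ k =
      Matrix.single 0 0 (a * q ^ k) := by
  induction k with
  | zero => simp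
  | succ k ih =>
    rw [pow_succ, ← mul_assoc, ih, Matrix.mul_smul, Matrix.single_mul_single_same, mul_one,
      Matrix.smul_single, smul_eq_mul, pow_succ]
    congr 1
    ring

/-- `(q • E₀₀)ᵏ = E₀₀(qᵏ)` for `k ≥ 1`. [folklore] -/
theorem smul_single_pow_succ (q : R) (k : ℕ) :
    (q • Matrix.single (0 : Fin n) (0 : Fin n) (1 : R)) ^ (k + 1) = Matrix.single 0 0 (q ^ (k + 1)) := by
  have h : q • Matrix.single (0 : Fin n) (0 : Fin n) (1 : R) = Matrix.single 0 0 q := by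
    rw [Matrix.smul_single, smul_eq_mul, mul_one]
  calc (q • Matrix.single (0 : Fin n) (0 : Fin n) (1 : R)) ^ (k + 1)
      = Matrix.single (0 : Fin n) (0 : Fin n) q *
          (q • Matrix.single (0 : Fin n) (0 : Fin n) (1 : R)) ^ k := by rw [pow_succ', h]
    _ = Matrix.single 0 0 (q * q ^ k) := single_mul_smul_single_pow q q k
    _ = Matrix.single 0 0 (q ^ (k + 1)) := by rw [pow_succ']

/-- `e₀ xᵀ · x e₀ᵀ = (x·x) E₀₀`. [folklore] -/
theorem vecMulVec_single_mul (x : Fin n → R) :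
    Matrix.vecMulVec (Pi.single 0 1) x * Matrix.vecMulVec x (Pi.single 0 1) =
      (x ⬝ᵥ x) • Matrix.single (0 : Fin n) (0 : Fin n) (1 : R) := by
  rw [Matrix.vecMulVec_mul_vecMulVec]
  ext i j
  simp only [Matrix.vecMulVec_apply, Matrix.smul_apply, Matrix.single_apply, Pi.single_apply,
    Pi.smul_apply, smul_eq_mul]
  by_cases hi : i = 0 <;> by_cases hj : j = 0 <;> simp [hi, hj, eq_comm]

/-- The alternating product `A B A B ⋯` of length `2k` is `(AB)ᵏ`. [folklore] -/
theorem prod_map_range_alternate {M : Type*} [Monoid M] (A B : M) (k : ℕ) :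
    ((List.range (2 * k)).map fun t => if t % 2 = 0 then A else B).prod = (A * B) ^ k := by
  induction k with
  | zero => simp
  | succ k ih =>
    rw [show 2 * (k + 1) = 2 * k + 1 + 1 by ring, List.range_succ, List.range_succ, List.map_append,
      List.map_append, List.prod_append, List.prod_append, ih, List.map_singleton,
      List.map_singleton, List.prod_singleton, List.prod_singleton, pow_succ, mul_assoc]
    congr 2
    · rw [if_pos (by omega)]
    · rw [if_neg (by omega)]

end MatrixLemmas

/-! ### The three degenerations -/

section Designs

variable {K : Type*} [CommRing K] {m n : ℕ}

/-- The source of the `j`-th coordinate of `x`: the variable `v j` for `j < z`, zero beyond. [folklore] -/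
theorem sum_xsrc_sq {σ : Type*} {z : ℕ} (hz : z ≤ n) (v : Fin z → σ) :
    (∑ j : Fin n, ((if h : (j : ℕ) < z then some (v ⟨j, h⟩) else none).elim (0 : MvPolynomial σ K) X) *
        ((if h : (j : ℕ) < z then some (v ⟨j, h⟩) else none).elim (0 : MvPolynomial σ K) X)) =
      ∑ i : Fin z, X (v i) ^ 2 := by
  set F : ℕ → MvPolynomial σ K := fun j => if h : j < z then X (v ⟨j, h⟩) ^ 2 else 0 with hF
  have h1 : ∀ j : Fin n, ((if h : (j : ℕ) < z then some (v ⟨j, h⟩) else none).elim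
      (0 : MvPolynomial σ K) X) * ((if h : (j : ℕ) < z then some (v ⟨j, h⟩) else none).elim
      (0 : MvPolynomial σ K) X) = F j := by
    intro j
    by_cases h : (j : ℕ) < z
    · simp [hF, h, sq]
    · simp [hF, h]
  have h2 : ∀ i : Fin z, X (v i) ^ 2 = F i := fun i => by simp [hF, i.2]
  simp_rw [h1, h2]
  rw [Fin.sum_univ_eq_sum_range F n, Fin.sum_univ_eq_sum_range F z]
  refine (Finset.sum_subset (Finset.range_subset_range.2 hz) fun j _ hj => ?_).symm
  rw [Finset.mem_range] at hj
  simp [hF, hj]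

variable [NeZero n]

/-- **The closed walk at vertex `0`**: keeping only the `(0,0)` entry `x⁽ᵗ⁾₀₀` of every matrix
degenerates `IMM^m_n` to the monomial `∏ₜ x⁽ᵗ⁾₀₀` (an element of `End · IMM^m_n`).
[cite: GesmundoLandsberg2017, Def. 1 and §4] -/
theorem exists_endOrbit_immPoly_eq_prod_X (hm : 1 ≤ m) :
    ∃ G ∈ endOrbit (Fin m × Fin n × Fin n) K (immPoly n m K),
      G = ∏ t : Fin m, X ((t, 0, 0) : Fin m × Fin n × Fin n) := by
  classical
  let d : Fin m × Fin n × Fin n → Option (Fin m × Fin n × Fin n) :=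
    fun v => if v.2.1 = 0 ∧ v.2.2 = 0 then some v else none
  refine ⟨_, aeval_option_mem_endOrbit d (immPoly n m K), ?_⟩
  rw [aeval_immPoly]
  have hmat : ∀ t : Fin m, (Matrix.of fun i j => ((d (t, i, j)).elim (0 : MvPolynomial _ K) X)) =
      Matrix.single 0 0 (X (t, 0, 0)) := by
    intro t
    ext i j
    simp only [Matrix.of_apply, Matrix.single_apply, d]
    by_cases hi : i = 0 <;> by_cases hj : j = 0
    · subst hi; subst hj; simp
    · simp [hi, hj, Ne.symm hj]
    · simp [hi, hj, Ne.symm hi]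
    · simp [hi, hj, Ne.symm hi]
  simp_rw [hmat]
  -- product of the singles
  have hprod : ∀ l : List (Fin m), l ≠ [] → ((l.map fun t => Matrix.single (0 : Fin n) (0 : Fin n)
      (X (t, 0, 0) : MvPolynomial (Fin m × Fin n × Fin n) K)).prod) =
      Matrix.single 0 0 (l.map fun t => (X (t, 0, 0) : MvPolynomial (Fin m × Fin n × Fin n) K)).prod := by
    intro l hl
    induction l with
    | nil => exact (hl rfl).elim
    | cons t l ih =>
      cases l with
      | nil => simp
      | cons t' l' =>
        rw [List.map_cons, List.prod_cons, ih (List.cons_ne_nil _ _), Matrix.single_mul_single_same]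
        simp only [List.map_cons, List.prod_cons]
  have hne : List.finRange m ≠ [] := by
    obtain ⟨m', rfl⟩ : ∃ m', m = m' + 1 := ⟨m - 1, by omega⟩
    rw [List.finRange_succ]; exact List.cons_ne_nil _ _
  rw [hprod _ hne, Matrix.trace_single_eq_same, ← List.ofFn_eq_map, List.prod_ofFn]

/-- The alternating first-row / first-column design: layer `t` of parity `0` becomes `e₀ xᵀ`,
of parity `1` becomes `x e₀ᵀ`, where `x_j = X_{v j}` for `j < z` and `x_j = 0` beyond. [folklore] -/
theorem of_alternateDesign {σ : Type*} {z : ℕ} (v : Fin z → σ) (par : ℕ) :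
    (Matrix.of fun i j : Fin n => ((if par % 2 = 0 then (if i = 0 then
        (if h : (j : ℕ) < z then some (v ⟨j, h⟩) else none) else none) else (if j = 0 then
        (if h : (i : ℕ) < z then some (v ⟨i, h⟩) else none) else none)).elim
        (0 : MvPolynomial σ K) X)) =
      if par % 2 = 0 then Matrix.vecMulVec (Pi.single 0 1)
          (fun j : Fin n => (if h : (j : ℕ) < z then some (v ⟨j, h⟩) else none).elim (0 : MvPolynomial σ K) X)
        else Matrix.vecMulVec
          (fun j : Fin n => (if h : (j : ℕ) < z then some (v ⟨j, h⟩) else none).elim (0 : MvPolynomial σ K) X)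
          (Pi.single 0 1) := by
  ext i j
  by_cases hp : par % 2 = 0
  · simp only [hp, if_true, Matrix.of_apply, Matrix.vecMulVec_apply, Pi.single_apply]
    by_cases hi : i = 0
    · simp [hi]
    · simp [hi]
  · simp only [hp, if_false, Matrix.of_apply, Matrix.vecMulVec_apply, Pi.single_apply]
    by_cases hj : j = 0
    · simp [hj]
    · simp [hj]

/-- **`IMM^{2k}_n` degenerates to `qᵏ`** (`k ≥ 1`), `q = Σ_{i<z} X_{v i}²` for any `z ≤ n` and any
choice `v` of `z` variables: take `X_{2u} = e₀ xᵀ`, `X_{2u+1} = x e₀ᵀ` with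
`x = (X_{v 0}, …, X_{v (z-1)}, 0, …, 0)`; then `X_{2u} X_{2u+1} = q E₀₀` and `trace((q E₀₀)ᵏ) = qᵏ`
— a coordinate substitute for GL's Prop. 9 ("we degenerate `IMM^m_n` to `f_{n,k}` if `m = 2k` is
even. This is possible by Proposition 9"). [cite: GesmundoLandsberg2017, Prop. 9 and §4 (Case 1)] -/
theorem exists_endOrbit_immPoly_eq_sumSq_pow {z : ℕ} (hz : z ≤ n) (k : ℕ)
    (v : Fin z → Fin (2 * (k + 1)) × Fin n × Fin n) :
    ∃ G ∈ endOrbit (Fin (2 * (k + 1)) × Fin n × Fin n) K (immPoly n (2 * (k + 1)) K),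
      G = (∑ i : Fin z, X (v i) ^ 2) ^ (k + 1) := by
  classical
  let xsrc : Fin n → Option (Fin (2 * (k + 1)) × Fin n × Fin n) :=
    fun j => if h : (j : ℕ) < z then some (v ⟨j, h⟩) else none
  let d : Fin (2 * (k + 1)) × Fin n × Fin n → Option (Fin (2 * (k + 1)) × Fin n × Fin n) :=
    fun w => if (w.1 : ℕ) % 2 = 0 then (if w.2.1 = 0 then xsrc w.2.2 else none)
      else (if w.2.2 = 0 then xsrc w.2.1 else none)
  refine ⟨_, aeval_option_mem_endOrbit d (immPoly n (2 * (k + 1)) K), ?_⟩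
  rw [aeval_immPoly]
  set x : Fin n → MvPolynomial (Fin (2 * (k + 1)) × Fin n × Fin n) K :=
    fun j => (xsrc j).elim 0 X with hx
  set A := Matrix.vecMulVec (Pi.single (0 : Fin n) (1 : MvPolynomial (Fin (2 * (k + 1)) × Fin n × Fin n) K)) x
    with hA
  set B := Matrix.vecMulVec x (Pi.single (0 : Fin n) (1 : MvPolynomial (Fin (2 * (k + 1)) × Fin n × Fin n) K))
    with hB
  have hmat : (fun t : Fin (2 * (k + 1)) => Matrix.of fun i j =>
      ((d (t, i, j)).elim (0 : MvPolynomial _ K) X)) =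
      (fun s : ℕ => if s % 2 = 0 then A else B) ∘ Fin.val := by
    funext t
    exact of_alternateDesign (K := K) v t.val
  rw [hmat, ← List.map_map, List.map_coe_finRange_eq_range, prod_map_range_alternate, hA, hB,
    vecMulVec_single_mul, smul_single_pow_succ, Matrix.trace_single_eq_same, dotProduct]
  congr 1
  exact sum_xsrc_sq (K := K) hz v

/-- **`IMM^{2k+1}_n` degenerates to `y · qᵏ`**, `q = Σ_{i<z} X_{v i}²` (`z ≤ n`) and `y = X_{y₀}` any
variable: layer `0` becomes `y E₀₀` and the remaining `2k` layers alternate `e₀ xᵀ`, `x e₀ᵀ` as in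
`exists_endOrbit_immPoly_eq_sumSq_pow`, so the product is `y qᵏ E₀₀`. This is our coordinate
substitute for GL's odd case ("to `f̃_{n,k}` if `m = 2k+1` is odd", `f̃ = ℓ qᵏ`): with `y₀` chosen
outside the variables of `q`, the derivatives of `y qᵏ` are read off those of `qᵏ` and GL's Thm. 7 is
not needed. [cite: GesmundoLandsberg2017, Prop. 9 and §4 (Case 1)] -/
theorem exists_endOrbit_immPoly_eq_X_mul_sumSq_pow {z : ℕ} (hz : z ≤ n) (k : ℕ)
    (v : Fin z → Fin (2 * k + 1) × Fin n × Fin n) (y₀ : Fin (2 * k + 1) × Fin n × Fin n) :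
    ∃ G ∈ endOrbit (Fin (2 * k + 1) × Fin n × Fin n) K (immPoly n (2 * k + 1) K),
      G = X y₀ * (∑ i : Fin z, X (v i) ^ 2) ^ k := by
  classical
  let xsrc : Fin n → Option (Fin (2 * k + 1) × Fin n × Fin n) :=
    fun j => if h : (j : ℕ) < z then some (v ⟨j, h⟩) else none
  let d : Fin (2 * k + 1) × Fin n × Fin n → Option (Fin (2 * k + 1) × Fin n × Fin n) :=
    fun w => if (w.1 : ℕ) = 0 then (if w.2.1 = 0 ∧ w.2.2 = 0 then some y₀ else none)
      else if ((w.1 : ℕ) + 1) % 2 = 0 then (if w.2.1 = 0 then xsrc w.2.2 else none)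
      else (if w.2.2 = 0 then xsrc w.2.1 else none)
  refine ⟨_, aeval_option_mem_endOrbit d (immPoly n (2 * k + 1) K), ?_⟩
  rw [aeval_immPoly]
  set x : Fin n → MvPolynomial (Fin (2 * k + 1) × Fin n × Fin n) K :=
    fun j => (xsrc j).elim 0 X with hx
  set A := Matrix.vecMulVec (Pi.single (0 : Fin n) (1 : MvPolynomial (Fin (2 * k + 1) × Fin n × Fin n) K)) x
    with hA
  set B := Matrix.vecMulVec x (Pi.single (0 : Fin n) (1 : MvPolynomial (Fin (2 * k + 1) × Fin n × Fin n) K))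
    with hB
  set Y := Matrix.single (0 : Fin n) (0 : Fin n) (X y₀ : MvPolynomial (Fin (2 * k + 1) × Fin n × Fin n) K)
    with hY
  have hmat : (fun t : Fin (2 * k + 1) => Matrix.of fun i j =>
      ((d (t, i, j)).elim (0 : MvPolynomial _ K) X)) =
      (fun s : ℕ => if s = 0 then Y else if (s + 1) % 2 = 0 then A else B) ∘ Fin.val := by
    funext t
    by_cases ht : (t : ℕ) = 0
    · simp only [Function.comp_apply, ht, if_true]
      ext i j
      simp only [Matrix.of_apply, hY, Matrix.single_apply, d, ht, if_true]
      by_cases hi : i = 0 <;> by_cases hj : j = 0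
      · subst hi; subst hj; simp
      · simp [hi, hj, Ne.symm hj]
      · simp [hi, hj, Ne.symm hi]
      · simp [hi, hj, Ne.symm hi]
    · simp only [Function.comp_apply, ht, if_false]
      have := of_alternateDesign (K := K) (n := n) v ((t : ℕ) + 1)
      simp only [d, ht, if_false]
      exact this
  have hrange : List.range (2 * k + 1) = 0 :: (List.range (2 * k)).map (· + 1) := by
    rw [show 2 * k + 1 = (2 * k) + 1 from rfl, List.range_succ_eq_map]
  rw [hmat, ← List.map_map, List.map_coe_finRange_eq_range, hrange, List.map_cons, List.prod_cons,
    List.map_map]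
  have hcomp : ((fun s : ℕ => if s = 0 then Y else if (s + 1) % 2 = 0 then A else B) ∘ (· + 1)) =
      fun s : ℕ => if s % 2 = 0 then A else B := by
    funext s
    simp only [Function.comp_apply, Nat.add_one_ne_zero, if_false]
    by_cases hs : s % 2 = 0
    · rw [if_pos (by omega), if_pos hs]
    · rw [if_neg (by omega), if_neg hs]
  rw [hcomp, prod_map_range_alternate, if_pos rfl, hA, hB, vecMulVec_single_mul, hY,
    single_mul_smul_single_pow, Matrix.trace_single_eq_same, dotProduct]
  congr 2
  exact sum_xsrc_sq (K := K) hz v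

end Designs

end Literature.Barriers.ValiantsHypothesis
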